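import Summits.QuantumFields.YangMills.Theses.RenyiTelescope

/-!
# Route `RenyiTelescope` — glue item `HistoryTailOfRenyiTelescope` (stmt-QuantumFields-27139): THE ABSTRACT BOOTSTRAP
# (support file; ideator seat `ym-r3-idea-2` g3, registered stub `stub_abstractBootstrap` of the glue skeleton v4)

THE STEP (§7 of the glue plan attached to the item).  The analytic heart of the glue proves, for one family `F` at coupling `γ` and every
depth `d ≥ h₀`, a UNIT-EVENT TAIL `u(d, J, p) ≤ B(d)` for ALL cut-offs `J ≥ 1` together with an INTERIOR MASS `P(d, J) ≥ 1/2`, where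
`u(d,J,p) = Gibbs^(F.refine d)_J(E_c(p) ∩ Int_J)` and `P(d,J) = Gibbs^(F.refine d)_J(Int_J)`.  The two feed each other: the interior complement
at `(d, J)` is a union of unit events of DEEPER refinements at SMALLER cut-offs `(d + h, J − h)`, and the Rényi telescope at `(d, J)` needs the
interior masses on `[J₀(d), J]` to be `≥ 1/2`.  This file isolates that induction from all measure theory and all constants:
`stub_abstractBootstrap` — for abstract arrays `u : (d : ℕ) → ℕ → ι d → ℝ` (`ι d` = the unit plaquettes at depth `d`), `P : ℕ → ℕ → ℝ`,
envelopes `ε` (fine regime) and `B` (final), fine-regime cut-offs `J₀ d ≥ 1`, a telescope constant `Λ` and a depth threshold `h₀`, IF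
(fine) `u(d,J,p) ≤ ε(d)` for `1 ≤ J ≤ J₀(d)`; (tel) for `J > J₀(d)`, interior masses `≥ 1/2` on `[J₀(d), J]` imply
`u(d,J,p) ≤ e^Λ·(u(d,J₀ d,p)/P(d,J₀ d))^(1/2)`; (compl) for `J ≥ 1`, the bounds `u(d+h, j, ·) ≤ B(d+h)` for all `h, j ≥ 1` with `j + h = J`
imply `P(d,J) ≥ 1/2`; (env) `0 ≤ ε ≤ B` and `e^Λ·(2ε(d))^(1/2) ≤ B(d)`; THEN `u(d,J,p) ≤ B(d)` and `P(d,J) ≥ 1/2` for all `d ≥ h₀`,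
`J ≥ 1`, `p` — by strong induction on the cut-off `J`, simultaneously in all depths.  The instantiation (the remaining registered stub
`stub_glueRest`): (fine) is crux `FineRegimeUnitTailL`; (tel) is crux `CutoffRenyiL` + the conditional telescope (`conditional_telescope_sqrt`,
landed) with the orders `q_J = λL^(2J)L^(−3(m+d)/2)/p_d²` and the budgets `Σ1/q ≤ 1/2`, `ΣD ≤ Λ`; (compl) is the plaquette-event transport
(`stub_plaquetteTransport`, landed) + the bare tail (`bareTailAt`) + the closure of the series `Σ_h card(d+h)·B(d+h) ≤ 1/2 − bare` for `d ≥ h₀`.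

WHAT THIS IS NOT: a lemma on real arrays; no Gibbs measure appears; the cruxes are untouched; nothing here bears on the Yang–Mills mass gap and
the rung R3 (`YM3TorusSU2`) is NOT proved.

References: T. Bałaban, CMP 102 (1985) 255–275 [Balaban1985UV3] ((7) p.257: the first-large-scale decomposition this induction organises);
C. King, CMP 103 (1986) 323–349 [King1986] (Thm 3.4: the run-by-run comparison the telescope abstracts).
-/

noncomputable section

namespace Summit.QuantumFields.YangMills.Theorems.RenyiTelescope

/-- **REGISTERED STUB `stub_abstractBootstrap` OF THE GLUE SKELETON v4 (item stmt-QuantumFields-27139)** — the bootstrap induction on the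
cut-off, abstracted from the measures: fine-regime bound + conditional telescope bound + interior-complement implication + envelope
inequalities ⇒ the unit-event tail `u ≤ B` and the interior mass `P ≥ 1/2` at every depth `d ≥ h₀` and cut-off `J ≥ 1`.
[cite: Balaban1985UV3, (7) p.257; King1986, Thm 3.4 p.334] -/
theorem stub_abstractBootstrap : ∀ (ι : ℕ → Type) (u : (d : ℕ) → ℕ → ι d → ℝ) (P : ℕ → ℕ → ℝ) (ε B : ℕ → ℝ) (J₀ : ℕ → ℕ) (Λ : ℝ) (h₀ : ℕ),
      (∀ d, h₀ ≤ d → 1 ≤ J₀ d ∧ 0 ≤ ε d ∧ ε d ≤ B d ∧ Real.exp Λ * (2 * ε d) ^ (1 / 2 : ℝ) ≤ B d) →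
      (∀ d J (p : ι d), h₀ ≤ d → 0 ≤ u d J p) →
      (∀ d J (p : ι d), h₀ ≤ d → 1 ≤ J → J ≤ J₀ d → u d J p ≤ ε d) →
      (∀ d J (p : ι d), h₀ ≤ d → J₀ d < J → (∀ J', J₀ d ≤ J' → J' ≤ J → 1 / 2 ≤ P d J') →
        u d J p ≤ Real.exp Λ * (u d (J₀ d) p / P d (J₀ d)) ^ (1 / 2 : ℝ)) →
      (∀ d J, h₀ ≤ d → 1 ≤ J →
        (∀ h j (p' : ι (d + h)), 1 ≤ h → 1 ≤ j → j + h = J → u (d + h) j p' ≤ B (d + h)) → 1 / 2 ≤ P d J) →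
      ∀ d J (p : ι d), h₀ ≤ d → 1 ≤ J → u d J p ≤ B d ∧ 1 / 2 ≤ P d J := by
  intro ι u P ε B J₀ Λ h₀ henv hu0 hfine htel hcompl
  -- strong induction on the cut-off, simultaneously in all depths `d ≥ h₀` and all unit plaquettes
  suffices key : ∀ J d, h₀ ≤ d → 1 ≤ J → (1 / 2 ≤ P d J) ∧ ∀ p : ι d, u d J p ≤ B d from
    fun d J p hd hJ => ⟨(key J d hd hJ).2 p, (key J d hd hJ).1⟩
  intro J
  induction J using Nat.strong_induction_on with
  | _ J ih =>
    intro d hd hJ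
    -- (B_J): the interior mass from the induction hypothesis at smaller cut-offs (deeper refinements)
    have hPJ : 1 / 2 ≤ P d J :=
      hcompl d J hd hJ fun h j p' hh hj hjh => ((ih j (by omega) (d + h) (by omega) hj).2 p')
    refine ⟨hPJ, fun p => ?_⟩
    obtain ⟨hJ₀, hε0, hεB, hΛB⟩ := henv d hd
    by_cases hJJ : J ≤ J₀ d
    · -- fine regime
      exact (hfine d J p hd hJ hJJ).trans hεB
    · -- above the fine regime: the telescope, with interior masses ≥ 1/2 on `[J₀ d, J]`
      rw [not_le] at hJJ
      have hpos : ∀ J', J₀ d ≤ J' → J' ≤ J → 1 / 2 ≤ P d J' := by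
        intro J' h1 h2
        rcases Nat.lt_or_ge J' J with hlt | hge
        · exact (ih J' hlt d hd (le_trans hJ₀ h1)).1
        · have hJ' : J' = J := le_antisymm h2 hge
          rw [hJ']
          exact hPJ
      have hP0 : 1 / 2 ≤ P d (J₀ d) := hpos (J₀ d) le_rfl hJJ.le
      have hP0pos : 0 < P d (J₀ d) := by linarith
      have hu₀ : u d (J₀ d) p ≤ ε d := hfine d (J₀ d) p hd hJ₀ le_rfl
      have hratio : u d (J₀ d) p / P d (J₀ d) ≤ 2 * ε d := by
        rw [div_le_iff₀ hP0pos]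
        nlinarith
      have hratio0 : 0 ≤ u d (J₀ d) p / P d (J₀ d) := div_nonneg (hu0 d (J₀ d) p hd) hP0pos.le
      calc u d J p ≤ Real.exp Λ * (u d (J₀ d) p / P d (J₀ d)) ^ (1 / 2 : ℝ) := htel d J p hd hJJ hpos
        _ ≤ Real.exp Λ * (2 * ε d) ^ (1 / 2 : ℝ) :=
            mul_le_mul_of_nonneg_left (Real.rpow_le_rpow hratio0 hratio (by norm_num)) (Real.exp_nonneg _)
        _ ≤ B d := hΛB

end Summit.QuantumFields.YangMills.Theorems.RenyiTelescope

end
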